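import Summits.QuantumFields.YangMills.Theorems.VirialFluxGapFixSlicePhaseModel
import Mathlib.Algebra.Algebra.Bilinear
import HarnessLib

/-!
# The quadratic part of the phase model along `fixSlice` is `½ Σ_t ‖S_t(y)‖_F²` for LINEAR matrix letters `S_t`
# (item (b) «hf» of the DIRECT Laplace road to ⟨stmt-QuantumFields-24204⟩ `VirialFluxGap.SharpTwistedLaplace`, operator form)

Helper module (free-hands work of width seat ym-line-sfw-p2-w2 g50, cell ym-idea-1; `--supports 24204`).  In ✓`AnchorSlice.abs_ringDeficit_fixSlice_sub_chartModel_le`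
the quadratic model `Q(y)` is a sum over temporal bonds, seam bonds and plaquettes of `½‖S_t(y)‖_F²`, where each `S_t(y)` is built from the letters
`quatMatrix(sliceLetterA y i e)`, `quatMatrix(sliceLetterB y x)` by sums, differences and conjugations `M ↦ P M Pᴴ` with FIXED unitary `P` — hence LINEAR in
`y` (✓`sliceLetterA_add/smul`, ✓`sliceLetterB_add/smul`, ✓`quatMatrixLinear`, `LinearMap.mulLeftRight`).
★ `exists_linear_forms_fixSlice_chartModel` packages this: there is a finite family of `ℝ`-linear maps
`S_t : ℝ³ × RestParam → M₂(ℂ)`, `t ∈ (Fin(2L−1) × Edge) ⊕ Edge ⊕ (Fin(2L−1+1) × Plaquette)`, with `Q(y) = (Σ_t ‖S_t y‖_F²)/2` for every `y` (the `X₂, X₃, Y₂, Y₃`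
of the model substituted by their defining expressions at the base ring `Q_s`).  Composed with the linear coordinate map `fixCoord` of ✓`VirialFluxGapFixCoordDefs`
and fed to ✓`QuantitativeLaplace.exists_symm_operator_sumSq_frob`, this yields the symmetric operator `A` with `½⟪Ay,y⟫ = Q` required by
✓`window_phase_data_of_model` ∕ the orbit Laplace theorem.  Everything here is PROVED; no definitions (namespace `Summit.QuantumFields.YangMills.Theorems.VirialFluxGap.AnchorSlice`).

HONEST FRAMING: bookkeeping; ⟨24204⟩, ⟨24319⟩, ⟨22884⟩ and every rung stay OPEN; the Yang–Mills mass gap (Clay) is NOT touched; no summit is proved by a line.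

## References
* M. Lüscher, Nucl. Phys. B219 (1983), §2. [Luscher1983]
* K. W. Breitung, *Asymptotic Approximations for Probability Integrals*, LNM 1592 (1994), Lemma 7 p. 12. [Breitung1994]
-/

set_option autoImplicit false

noncomputable section

open scoped Quaternion RealInnerProductSpace BigOperators Matrix Matrix.Norms.Frobenius
open NormedSpace
open Literature.MathematicalPhysics.QuantumFieldTheory hiding SU2 su2Quat_mul
open Literature.MathematicalPhysics.QuantumLattice
open Literature.Geometry.GaugeTheory (quatMatrixLinear quatMatrixLinear_apply)
open Literature.MathematicalPhysics.QuantumFieldTheory.Balaban1983to89.T4HaarSU2ExpChart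
open Summit.QuantumFields.YangMills.Theorems.FemtoTransferGap
open Summit.QuantumFields.YangMills.Theorems.FemtoTransferGap.TT
open Summit.QuantumFields.YangMills.Theorems.FemtoTransferGap.TwoLattice
open Summit.QuantumFields.YangMills.Theorems.FemtoTransferGap.TwoLattice.Flat
open Summit.QuantumFields.YangMills.Theorems.VirialFluxGap.FixSplit
open Summit.QuantumFields.YangMills.Theorems.QuantitativeLaplace (not_treeEdge_wrap)

namespace Summit.QuantumFields.YangMills.Theorems.VirialFluxGap.AnchorSlice

variable {L : ℕ} [NeZero L]

/-- ★ **The quadratic phase model along `fixSlice` is half a sum of squared Frobenius norms of LINEAR matrix letters.**  For the base ring `Q_s`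
(links `W = combFlat w_s`, seam `λ·C₀`) there are `ℝ`-linear `S_t : ℝ³ × RestParam → M₂(ℂ)`, indexed by temporal bonds `(i,e)`, seam bonds `e` and plaquettes
`(i,p)`, such that the quadratic part of ✓`abs_ringDeficit_fixSlice_sub_chartModel_le` (with `X₂, X₃, Y₂, Y₃` substituted) equals `(Σ_t ‖S_t y‖_F²)/2`.
[cite: Luscher1983, §2] [cite: Breitung1994, Lemma 7 p. 12] -/
theorem exists_linear_forms_fixSlice_chartModel (hL : 2 ≤ L) (z : Fin 3 → Bool) (k₀ : Fin 3) (lam : Site 3 L → SU2) (N₀ C₀ : SU2)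
    (ωC ωN ωX : EuclideanSpace ℝ (Fin 3)) (s : Fin 3 → Bool) :
    ∃ S : ((Fin (2 * L - 1) × Edge 3 L) ⊕ (Edge 3 L ⊕ (Fin (2 * L - 1 + 1) × Plaquette 3 L))) →
        ((EuclideanSpace ℝ (Fin 3) × RestParam L ⟨(((fun _ => (-1 : ZMod L)), k₀) : Edge 3 L), not_treeEdge_wrap hL k₀⟩ 0) →ₗ[ℝ]
          Matrix (Fin 2) (Fin 2) ℂ),
      ∀ y : EuclideanSpace ℝ (Fin 3) × RestParam L ⟨(((fun _ => (-1 : ZMod L)), k₀) : Edge 3 L), not_treeEdge_wrap hL k₀⟩ 0,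
        ((∑ i : Fin (2 * L - 1), ∑ e : Edge 3 L, ‖quatMatrix (sliceLetterA ωN ωX y i.castSucc e) - quatMatrix (sliceLetterA ωN ωX y i.succ e)‖ ^ 2 / 2) +
          (∑ e : Edge 3 L, ‖quatMatrix (sliceLetterA ωN ωX y (Fin.last (2 * L - 1)) e) +
            ((combFlat (fun a => centreElem (s a) * (if z a then N₀ else 1)) e : SU2) : Matrix (Fin 2) (Fin 2) ℂ) *
              quatMatrix (sliceLetterB ωC y (e.1.shift e.2)) * ((combFlat (fun a => centreElem (s a) * (if z a then N₀ else 1)) e : SU2) : Matrix (Fin 2) (Fin 2) ℂ)ᴴ -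
            (((combFlat (fun a => centreElem (s a) * (if z a then N₀ else 1)) e : SU2) : Matrix (Fin 2) (Fin 2) ℂ) *
              ((lam (e.1.shift e.2) * C₀ : SU2) : Matrix (Fin 2) (Fin 2) ℂ) * ((combFlat (fun a => centreElem (s a) * (if z a then N₀ else 1)) e : SU2) : Matrix (Fin 2) (Fin 2) ℂ)ᴴ) *
              quatMatrix (sliceLetterA ωN ωX y 0 e) *
              (((combFlat (fun a => centreElem (s a) * (if z a then N₀ else 1)) e : SU2) : Matrix (Fin 2) (Fin 2) ℂ) *
                ((lam (e.1.shift e.2) * C₀ : SU2) : Matrix (Fin 2) (Fin 2) ℂ) * ((combFlat (fun a => centreElem (s a) * (if z a then N₀ else 1)) e : SU2) : Matrix (Fin 2) (Fin 2) ℂ)ᴴ)ᴴ -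
            quatMatrix (sliceLetterB ωC y e.1)‖ ^ 2 / 2) +
          ∑ i : Fin (2 * L - 1 + 1), ∑ p : Plaquette 3 L, ‖quatMatrix (sliceLetterA ωN ωX y i (p.1, p.2.1.1)) +
            ((combFlat (fun a => centreElem (s a) * (if z a then N₀ else 1)) (p.1, p.2.1.1) : SU2) : Matrix (Fin 2) (Fin 2) ℂ) *
              quatMatrix (sliceLetterA ωN ωX y i (p.1.shift p.2.1.1, p.2.1.2)) *
              ((combFlat (fun a => centreElem (s a) * (if z a then N₀ else 1)) (p.1, p.2.1.1) : SU2) : Matrix (Fin 2) (Fin 2) ℂ)ᴴ -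
            (((combFlat (fun a => centreElem (s a) * (if z a then N₀ else 1)) (p.1, p.2.1.1) : SU2) : Matrix (Fin 2) (Fin 2) ℂ) *
                ((combFlat (fun a => centreElem (s a) * (if z a then N₀ else 1)) (p.1.shift p.2.1.1, p.2.1.2) : SU2) : Matrix (Fin 2) (Fin 2) ℂ) *
                ((combFlat (fun a => centreElem (s a) * (if z a then N₀ else 1)) (p.1.shift p.2.1.2, p.2.1.1) : SU2) : Matrix (Fin 2) (Fin 2) ℂ)ᴴ) *
              quatMatrix (sliceLetterA ωN ωX y i (p.1.shift p.2.1.2, p.2.1.1)) *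
              (((combFlat (fun a => centreElem (s a) * (if z a then N₀ else 1)) (p.1, p.2.1.1) : SU2) : Matrix (Fin 2) (Fin 2) ℂ) *
                ((combFlat (fun a => centreElem (s a) * (if z a then N₀ else 1)) (p.1.shift p.2.1.1, p.2.1.2) : SU2) : Matrix (Fin 2) (Fin 2) ℂ) *
                ((combFlat (fun a => centreElem (s a) * (if z a then N₀ else 1)) (p.1.shift p.2.1.2, p.2.1.1) : SU2) : Matrix (Fin 2) (Fin 2) ℂ)ᴴ)ᴴ -
            quatMatrix (sliceLetterA ωN ωX y i (p.1, p.2.1.2))‖ ^ 2 / 2) =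
        (∑ t, ‖S t y‖ ^ 2) / 2 := by
  -- abbreviations
  obtain ⟨W, hW⟩ : ∃ W : Edge 3 L → Matrix (Fin 2) (Fin 2) ℂ,
      W = fun e => ((combFlat (fun a => centreElem (s a) * (if z a then N₀ else 1)) e : SU2) : Matrix (Fin 2) (Fin 2) ℂ) := ⟨_, rfl⟩
  obtain ⟨G, hG⟩ : ∃ G : Site 3 L → Matrix (Fin 2) (Fin 2) ℂ, G = fun x => ((lam x * C₀ : SU2) : Matrix (Fin 2) (Fin 2) ℂ) := ⟨_, rfl⟩
  -- the letters as linear maps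
  let Y := EuclideanSpace ℝ (Fin 3) × RestParam L ⟨(((fun _ => (-1 : ZMod L)), k₀) : Edge 3 L), not_treeEdge_wrap hL k₀⟩ 0
  let LA : Fin (2 * L - 1 + 1) → Edge 3 L → (Y →ₗ[ℝ] Matrix (Fin 2) (Fin 2) ℂ) := fun i e =>
    { toFun := fun y => quatMatrix (sliceLetterA ωN ωX y i e)
      map_add' := fun y y' => by
        rw [sliceLetterA_add, Pi.add_apply, Pi.add_apply, ← quatMatrixLinear_apply, map_add, quatMatrixLinear_apply, quatMatrixLinear_apply]
      map_smul' := fun c y => by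
        rw [sliceLetterA_smul, Pi.smul_apply, Pi.smul_apply, ← quatMatrixLinear_apply, map_smul, quatMatrixLinear_apply, RingHom.id_apply] }
  let LB : Site 3 L → (Y →ₗ[ℝ] Matrix (Fin 2) (Fin 2) ℂ) := fun x =>
    { toFun := fun y => quatMatrix (sliceLetterB ωC y x)
      map_add' := fun y y' => by
        rw [sliceLetterB_add, Pi.add_apply, ← quatMatrixLinear_apply, map_add, quatMatrixLinear_apply, quatMatrixLinear_apply]
      map_smul' := fun c y => by
        rw [sliceLetterB_smul, Pi.smul_apply, ← quatMatrixLinear_apply, map_smul, quatMatrixLinear_apply, RingHom.id_apply] }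
  have hLA : ∀ i e (y : Y), LA i e y = quatMatrix (sliceLetterA ωN ωX y i e) := fun _ _ _ => rfl
  have hLB : ∀ x (y : Y), LB x y = quatMatrix (sliceLetterB ωC y x) := fun _ _ => rfl
  -- conjugation by a fixed matrix
  let K : Matrix (Fin 2) (Fin 2) ℂ → (Matrix (Fin 2) (Fin 2) ℂ →ₗ[ℝ] Matrix (Fin 2) (Fin 2) ℂ) := fun P => LinearMap.mulLeftRight ℝ (P, Pᴴ)
  have hK : ∀ P M, K P M = P * M * Pᴴ := fun P M => rfl
  -- the three families
  let S : ((Fin (2 * L - 1) × Edge 3 L) ⊕ (Edge 3 L ⊕ (Fin (2 * L - 1 + 1) × Plaquette 3 L))) → (Y →ₗ[ℝ] Matrix (Fin 2) (Fin 2) ℂ) :=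
    fun t => match t with
    | Sum.inl x => LA x.1.castSucc x.2 - LA x.1.succ x.2
    | Sum.inr (Sum.inl e) => LA (Fin.last (2 * L - 1)) e + K (W e) ∘ₗ LB (e.1.shift e.2) - K (W e * G (e.1.shift e.2) * (W e)ᴴ) ∘ₗ LA 0 e - LB e.1
    | Sum.inr (Sum.inr x) => LA x.1 (x.2.1, x.2.2.1.1) + K (W (x.2.1, x.2.2.1.1)) ∘ₗ LA x.1 (x.2.1.shift x.2.2.1.1, x.2.2.1.2) -
        K (W (x.2.1, x.2.2.1.1) * W (x.2.1.shift x.2.2.1.1, x.2.2.1.2) * (W (x.2.1.shift x.2.2.1.2, x.2.2.1.1))ᴴ) ∘ₗ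
          LA x.1 (x.2.1.shift x.2.2.1.2, x.2.2.1.1) - LA x.1 (x.2.1, x.2.2.1.2)
  have hS1 : ∀ (x : Fin (2 * L - 1) × Edge 3 L) (y : Y), S (Sum.inl x) y =
      quatMatrix (sliceLetterA ωN ωX y x.1.castSucc x.2) - quatMatrix (sliceLetterA ωN ωX y x.1.succ x.2) := fun _ _ => rfl
  have hS2 : ∀ (e : Edge 3 L) (y : Y), S (Sum.inr (Sum.inl e)) y =
      quatMatrix (sliceLetterA ωN ωX y (Fin.last (2 * L - 1)) e) + W e * quatMatrix (sliceLetterB ωC y (e.1.shift e.2)) * (W e)ᴴ -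
        (W e * G (e.1.shift e.2) * (W e)ᴴ) * quatMatrix (sliceLetterA ωN ωX y 0 e) * (W e * G (e.1.shift e.2) * (W e)ᴴ)ᴴ -
        quatMatrix (sliceLetterB ωC y e.1) := fun _ _ => rfl
  have hS3 : ∀ (x : Fin (2 * L - 1 + 1) × Plaquette 3 L) (y : Y), S (Sum.inr (Sum.inr x)) y =
      quatMatrix (sliceLetterA ωN ωX y x.1 (x.2.1, x.2.2.1.1)) +
        W (x.2.1, x.2.2.1.1) * quatMatrix (sliceLetterA ωN ωX y x.1 (x.2.1.shift x.2.2.1.1, x.2.2.1.2)) * (W (x.2.1, x.2.2.1.1))ᴴ -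
        (W (x.2.1, x.2.2.1.1) * W (x.2.1.shift x.2.2.1.1, x.2.2.1.2) * (W (x.2.1.shift x.2.2.1.2, x.2.2.1.1))ᴴ) *
          quatMatrix (sliceLetterA ωN ωX y x.1 (x.2.1.shift x.2.2.1.2, x.2.2.1.1)) *
          (W (x.2.1, x.2.2.1.1) * W (x.2.1.shift x.2.2.1.1, x.2.2.1.2) * (W (x.2.1.shift x.2.2.1.2, x.2.2.1.1))ᴴ)ᴴ -
        quatMatrix (sliceLetterA ωN ωX y x.1 (x.2.1, x.2.2.1.2)) := fun _ _ => rfl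
  refine ⟨S, fun y => ?_⟩
  rw [Fintype.sum_sum_type, Fintype.sum_sum_type]
  have e1 : ∑ x : Fin (2 * L - 1) × Edge 3 L, ‖S (Sum.inl x) y‖ ^ 2 =
      ∑ i : Fin (2 * L - 1), ∑ e : Edge 3 L, ‖quatMatrix (sliceLetterA ωN ωX y i.castSucc e) - quatMatrix (sliceLetterA ωN ωX y i.succ e)‖ ^ 2 := by
    rw [Fintype.sum_prod_type]
    simp only [hS1]
  have e2 : ∑ e : Edge 3 L, ‖S (Sum.inr (Sum.inl e)) y‖ ^ 2 = ∑ e : Edge 3 L, ‖quatMatrix (sliceLetterA ωN ωX y (Fin.last (2 * L - 1)) e) +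
      W e * quatMatrix (sliceLetterB ωC y (e.1.shift e.2)) * (W e)ᴴ -
        (W e * G (e.1.shift e.2) * (W e)ᴴ) * quatMatrix (sliceLetterA ωN ωX y 0 e) * (W e * G (e.1.shift e.2) * (W e)ᴴ)ᴴ -
        quatMatrix (sliceLetterB ωC y e.1)‖ ^ 2 := by
    simp only [hS2]
  have e3 : ∑ x : Fin (2 * L - 1 + 1) × Plaquette 3 L, ‖S (Sum.inr (Sum.inr x)) y‖ ^ 2 =
      ∑ i : Fin (2 * L - 1 + 1), ∑ p : Plaquette 3 L, ‖quatMatrix (sliceLetterA ωN ωX y i (p.1, p.2.1.1)) +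
        W (p.1, p.2.1.1) * quatMatrix (sliceLetterA ωN ωX y i (p.1.shift p.2.1.1, p.2.1.2)) * (W (p.1, p.2.1.1))ᴴ -
        (W (p.1, p.2.1.1) * W (p.1.shift p.2.1.1, p.2.1.2) * (W (p.1.shift p.2.1.2, p.2.1.1))ᴴ) *
          quatMatrix (sliceLetterA ωN ωX y i (p.1.shift p.2.1.2, p.2.1.1)) *
          (W (p.1, p.2.1.1) * W (p.1.shift p.2.1.1, p.2.1.2) * (W (p.1.shift p.2.1.2, p.2.1.1))ᴴ)ᴴ -
        quatMatrix (sliceLetterA ωN ωX y i (p.1, p.2.1.2))‖ ^ 2 := by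
    rw [Fintype.sum_prod_type]
    simp only [hS3]
  rw [e1, e2, e3, hW, hG, add_div, add_div, Finset.sum_div, Finset.sum_div, Finset.sum_div, add_assoc]
  simp only [Finset.sum_div]

end Summit.QuantumFields.YangMills.Theorems.VirialFluxGap.AnchorSlice
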